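import Summits.CriticalPhenomena.CardyFormulaZ2.Theorems.CardyMagicRigidityNestingRigidityNeckErrorCoverT
import HarnessLib

/-!
# Crux `NestingRigidity`, line `pinch-resampling` (v4), stub S11: the parameters of the necklace summation on `𝕋` and the degenerate scale

Crux `Summit.CriticalPhenomena.CardyFormulaZ2.Theses.CardyMagicRigidity.NestingRigidity` (stmt-CriticalPhenomena-4835),
line `pinch-resampling` v4, stub S11 `stub_neckHookupCoarseT : NeckHookupCoarseT`.  Worker W6c, wave 6: the site-`𝕋` twin of
`…NeckZ2SkeletonParams` (worker W6a).  The arm scales (`arm_params` / `skeleton_arm_params`: `Jz`, `R₀` from `L`, `K`, `lam`,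
`ℓ`) are lattice-free and REUSED; here the two `𝕋`-specific pieces of plumbing:

* `tNodeEventChainA_zero` — at scale `s = 0` the necklace node event `TNodeEventChainA` is empty (no inner layer);
* `tri_cells_param` (registered anchor `tri_skeleton_cells_param`) — `Nc := (6 (s+1) + ℓ - 1)/ℓ` satisfies
  `(Nc - 1) ℓ < 6 (s + 1) ≤ Nc ℓ` (`ℓ ≥ 1`): the hexagonal ring `{|· - x|_𝕋 = s + 1}` has `6 (s + 1)` sites.
-/

noncomputable section

namespace Summit.CriticalPhenomena.CardyFormulaZ2.Cruxes.NestingRigidity.PinchResampling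

open MeasureTheory Set Literature.Probability.Percolation Literature.Probability.LatticeModels

/-- **At scale `s = 0` the necklace node event on `𝕋` is empty.** -/
theorem tNodeEventChainA_zero (ℓ lam : ℕ) (x o : Site 2) : TNodeEventChainA ℓ lam 0 x o = ∅ := by
  ext η
  simp only [mem_empty_iff_false, iff_false]
  rintro ⟨b, b', F, hb, -⟩
  obtain ⟨⟨⟨hbO, hbI⟩, -⟩, -⟩ := hb
  exact hbI (by simpa using hbO)

/-- **The number of cells of the hexagonal ring**: `Nc := (6 (s + 1) + ℓ - 1) / ℓ` has `(Nc - 1) ℓ < 6 (s + 1) ≤ Nc ℓ`. -/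
theorem tri_cells_param {ℓ : ℕ} (hℓ : 1 ≤ ℓ) (s : ℕ) :
    6 * ((s : ℤ) + 1) ≤ (((6 * (s + 1) + ℓ - 1) / ℓ : ℕ) : ℤ) * ℓ ∧
      ((((6 * (s + 1) + ℓ - 1) / ℓ : ℕ) : ℤ) - 1) * (ℓ : ℤ) < 6 * ((s : ℤ) + 1) := by
  -- adapted from `cells_param` (`…NeckZ2SkeletonParams`), `8 ↦ 6`
  set Nc := (6 * (s + 1) + ℓ - 1) / ℓ with hNc
  have h1 : Nc * ℓ ≤ 6 * (s + 1) + ℓ - 1 := Nat.div_mul_le_self _ _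
  have h2 : 6 * (s + 1) + ℓ - 1 < Nc * ℓ + ℓ := Nat.lt_div_mul_add (by omega)
  set P := Nc * ℓ with hP
  have hlow : 6 * (s + 1) ≤ P := by omega
  constructor
  · have : ((6 * (s + 1) : ℕ) : ℤ) ≤ ((P : ℕ) : ℤ) := by exact_mod_cast hlow
    push_cast at this
    rw [hP] at this
    push_cast at this
    linarith
  · have : ((P : ℕ) : ℤ) + 1 ≤ ((6 * (s + 1) + ℓ : ℕ) : ℤ) := by exact_mod_cast (by omega : P + 1 ≤ 6 * (s + 1) + ℓ)
    push_cast at this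
    rw [hP] at this
    push_cast at this
    nlinarith

/-- **The cell count of the hexagonal ring (registered helper, anchor of this module on the crux item)**: for `ℓ ≥ 1` the
choice `Nc := (6 (s + 1) + ℓ - 1) / ℓ` satisfies `6 (s + 1) ≤ Nc ℓ` and `(Nc - 1) ℓ < 6 (s + 1)` — the hypotheses `hNc`,
`hNc'` of the `𝕋` skeleton bricks (`…NeckRingIndexCellsT` … `…NeckSkeletonSlotsEventT`). -/
theorem tri_skeleton_cells_param : ∀ (ℓ s : ℕ), 1 ≤ ℓ → 6 * ((s : ℤ) + 1) ≤ (((6 * (s + 1) + ℓ - 1) / ℓ : ℕ) : ℤ) * ℓ ∧ ((((6 * (s + 1) + ℓ - 1) / ℓ : ℕ) : ℤ) - 1) * (ℓ : ℤ) < 6 * ((s : ℤ) + 1) :=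
  fun _ s hℓ ↦ tri_cells_param hℓ s

end Summit.CriticalPhenomena.CardyFormulaZ2.Cruxes.NestingRigidity.PinchResampling

end
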